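/-
Copyright (c) 2026 the pub-hodgecm-mathlib formalisation cell (harness21).  Prover seat hodgecm-mathlib-K2E4-p10 (g7), Track B ∕ K2-LIT, h413 = `stmt-HodgeConjecture-24833`,
line `K2_E1_TraceFormulaBeta`, 5Res ROADCARD AMENDMENT #3 «GENERAL (U,τ) LADDER» rung G0, CM∕unitary half (dealer K2E1-plan (g7) (266)∕(270)): the SELF-CONJUGATE PRINCIPAL
CONGRUENCE LEVELS OF RATIONAL LEVEL `m ∈ ℕ` ARE COFINAL among the open subgroups of `U(J)(𝔸_{F,f})` — the `hcof` input of ★ p860858 `atoms_of_cofinal`.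
-/
import Literature.NumberTheory.Automorphic.UnitaryGroupRestrictedProduct        -- ★ `finAdelic`
import Literature.NumberTheory.Automorphic.UnramifiedHeckeScalarsProofs          -- ★ `exists_principalCongruenceLevel_subset` (the `K(𝔫)` are a basis of `𝓝 1` in `GL_n(𝔸)`)
import Literature.NumberTheory.Automorphic.UnramifiedHeckeLevel                  -- ★ `principalCongruenceLevel_mono`
import Literature.NumberTheory.Automorphic.AshSmithTheoryHeckeLevelProofs         -- ★ `isOpen_comap_ofFinite_principalCongruenceLevel`
import Literature.NumberTheory.Automorphic.AutomorphicFormsGLContinuous          -- ★ `GLn.continuous_sndHom`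
import Literature.NumberTheory.Automorphic.AutomorphicGaloisConj                 -- ★ `Ideal.smul_map_algebraMap` (ideals extended from `𝓞 F` are `Gal(E∕F)`-stable)
import Mathlib.RingTheory.Ideal.Norm.AbsNorm
import HarnessLib

/-!
# 5Res AMENDMENT #3, rung G0 (CM∕unitary half) — `K2E1SelfConjugateLevelsCofinalCM`: every open subgroup of `U(J)(𝔸_{F,f})` contains a principal congruence level `K_f(m𝓞_E)`, `m ∈ ℕ`,
# and these levels are `c`-stable (`c • m𝓞_E = m𝓞_E`) — the `hcof` input of ★ `K2E1ResidualLevelFiniteOfCofinalU.atoms_of_cofinal`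

Track B ∕ K2-LIT, crux h413 = `stmt-HodgeConjecture-24833`, route of record `HCCMUnconditional`; cell `hodgecm-mathlib`, squad K2, ENGINE E1 (5Res ∕ 12R3); dealer K2E1-plan (g7) rulings
(266) §0 and (270) («take `𝔫 := N·𝒪`: principal congruence subgroups of rational level are `c`-stable and cofinal; ★ `GLnAdelicStructure` :410 currency»).  THEOREMS ONLY (no `def`, no
`instance`, no `notation`, no named-fact hypothesis, no `sorry`); lane `--supports stmt-HodgeConjecture-24833 --as helper` (count-neutral).  GENERIC quadratic datum `(F, E, c, N, J)`
(the CM pair `(L⁺, L, conj)` is an instance; nothing CM-specific is used).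
THE MATHEMATICS ([Bump1997, §3.3 Prop. 3.3.x: the congruence subgroups of `∏_v GL_n(𝔬_v)` form a basis of neighbourhoods of `1` in `GL_n(𝔸_f)`]; [GodementJacquet1972, §10]; [PlatonovRapinchuk1994,
§5.1]).  Let `U ≤ U(J)(𝔸_{F,f}) ≤ GL_N(𝔸_{E,f})` be an open subgroup.  By the subspace topology `U = U(J)(𝔸_{F,f}) ∩ V` with `V ⊆ GL_N(𝔸_{E,f})` open, `1 ∈ V`; pulling back along the
continuous finite-component map `GL_N(𝔸_E) → GL_N(𝔸_{E,f})` (★ `GLn.continuous_sndHom`) gives a neighbourhood of `1` in `GL_N(𝔸_E)`, which contains a principal congruence subgroup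
`K(𝔫₀) = {1_∞} × K_f(𝔫₀)`, `𝔫₀ ≠ 0` (★ `exists_principalCongruenceLevel_subset`).  The RATIONAL level `m := N(𝔫₀) ∈ 𝔫₀` (Mathlib `Ideal.absNorm_mem`) gives `m𝓞_E ⊆ 𝔫₀`, so
`K(m𝓞_E) ≤ K(𝔫₀)` (★ `principalCongruenceLevel_mono`); and for `g ∈ U(J)(𝔸_{F,f})` with `(1_∞, g) ∈ K(m𝓞_E)`: `g = ((1_∞,g))_f ∈ V` (★ `GLn.sndHom_ofFinite`), i.e. `g ∈ U` (§2).  The level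
`m𝓞_E` is extended from `𝓞 F` (indeed from `ℤ`), hence `c • m𝓞_E = m𝓞_E` (★ `Ideal.smul_map_algebraMap`, §1); the level set `{g | (1_∞,g) ∈ K(𝔫)}` is open in `U(J)(𝔸_{F,f})` (★
`isOpen_comap_ofFinite_principalCongruenceLevel`, §1).  §3 packages this as the `hcof` binder of ★ p860858 `atoms_of_cofinal` with index `ι := {𝔫 // 𝔫 ≠ 0 ∧ c • 𝔫 = 𝔫}`, `good := ⊤`,
`𝒰 𝔫 :=` the open subgroup `{g | (1_∞, g) ∈ K(𝔫)}` of `U(J)(𝔸_{F,f})`.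
* §1 `map_span_natCast`, **`smul_span_natCast`** (`c • m𝓞_E = m𝓞_E`), `span_natCast_ne_zero`, **`isOpen_setOf_ofFinite_mem_principalCongruenceLevel`**.
* §2 HEAD **`exists_rationalLevel_subset`** (`∀ U open ≤ U(J)(𝔸_{F,f}), ∃ m ≠ 0, {g | (1_∞,g) ∈ K(m𝓞_E)} ⊆ U`), **`exists_selfConjugateLevel_subset`** (`∃ 𝔫 ≠ 0, c • 𝔫 = 𝔫 ∧ …`).
* §3 **`hcof_selfConjugateLevels`** — the `hcof` binder of ★ `atoms_of_cofinal` VERBATIM for `(Kf, ι, good, 𝒰) := (U(J)(𝔸_{F,f}), {𝔫 // 𝔫 ≠ 0 ∧ c • 𝔫 = 𝔫}, ⊤, 𝔫 ↦ K_f(𝔫) ∩ U(J))`.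
HONEST LABEL: HC_CM is proved only modulo the 7 printed citations (2 remaining named inputs: hLiu418 = `stmt-HodgeConjecture-24832`, h413 = `stmt-HodgeConjecture-24833`) until rung 0
closes; this file asserts no named fact and closes no socket; count-neutral; unconditional topology∕arithmetic of levels.

## References
* [Bump1997] D. Bump, *Automorphic Forms and Representations* (1997), §3.3.
* [GodementJacquet1972] R. Godement, H. Jacquet, *Zeta functions of simple algebras*, LNM 260 (1972), §10.
* [PlatonovRapinchuk1994] V. Platonov, A. Rapinchuk, *Algebraic Groups and Number Theory* (1994), §5.1.
-/

set_option autoImplicit false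
-- the mandated namespace repeats the single-problem summit's segment (`HodgeConjecture.HodgeConjecture`)
set_option linter.dupNamespace false

noncomputable section

open NumberField IsDedekindDomain Filter Topology Set
open scoped Pointwise
open Literature.NumberTheory.Automorphic Literature.NumberTheory.Automorphic.UnitaryGroup AdelicGroupData

namespace Summit.HodgeConjecture.HodgeConjecture.Cruxes.H413.K2E1SelfConjugateLevelsCofinalCM

variable (F E : Type) [Field F] [Field E] [NumberField E] [Algebra F E]
variable (c : E ≃ₐ[F] E) (N : ℕ) (J : Matrix (Fin N) (Fin N) E)

/-! ## §1 The rational levels `m𝓞_E`: extended from `𝓞 F`, `c`-stable, non-zero; their level sets are open in `U(J)(𝔸_{F,f})` -/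

omit [NumberField E] in
/-- `m𝓞_E` is the extension of `m𝓞_F` (`m ∈ ℕ`). [folklore] -/
theorem map_span_natCast (m : ℕ) : (Ideal.span {(m : 𝓞 F)}).map (algebraMap (𝓞 F) (𝓞 E)) = Ideal.span {(m : 𝓞 E)} := by
  rw [Ideal.map_span, Set.image_singleton, map_natCast]

omit [NumberField E] in
/-- **THE RATIONAL LEVELS ARE SELF-CONJUGATE**: `c • m𝓞_E = m𝓞_E` for every `c ∈ Aut(E∕F)` and `m ∈ ℕ` (ideals extended from `𝓞 F` are `Aut(E∕F)`-stable, ★ `Ideal.smul_map_algebraMap`).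
[cite: PlatonovRapinchuk1994, §5.1] -/
theorem smul_span_natCast (m : ℕ) : c • Ideal.span {(m : 𝓞 E)} = Ideal.span {(m : 𝓞 E)} := by
  rw [← map_span_natCast F E m, Ideal.smul_map_algebraMap F c (Ideal.span {(m : 𝓞 F)})]

omit [Algebra F E] in
/-- `m𝓞_E ≠ 0` for `m ≠ 0`. [folklore] -/
theorem span_natCast_ne_zero {m : ℕ} (hm : m ≠ 0) : Ideal.span {(m : 𝓞 E)} ≠ 0 := by
  rw [Ne, Submodule.zero_eq_bot, Ideal.span_singleton_eq_bot]
  exact Nat.cast_ne_zero.2 hm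

/-- **THE LEVEL SET `{g ∈ U(J)(𝔸_{F,f}) | (1_∞, g) ∈ K(𝔫)}` IS OPEN** (`𝔫 ≠ 0`): the trace on `U(J)(𝔸_{F,f})` of the open `K_f(𝔫) ≤ GL_N(𝔸_{E,f})`
(★ `isOpen_comap_ofFinite_principalCongruenceLevel`). [cite: Bump1997, §3.3] -/
theorem isOpen_setOf_ofFinite_mem_principalCongruenceLevel {𝔫 : Ideal (𝓞 E)} (h𝔫 : 𝔫 ≠ 0) :
    IsOpen {g : ↥(finAdelic F E c N J) | GLn.ofFinite N E (g : GL (Fin N) (FiniteAdeleRing (𝓞 E) E)) ∈ principalCongruenceLevel N E 𝔫} :=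
  (isOpen_comap_ofFinite_principalCongruenceLevel (n := N) (K := E) h𝔫).preimage continuous_subtype_val

/-! ## §2 Every open subgroup of `U(J)(𝔸_{F,f})` contains a rational (hence self-conjugate) principal congruence level -/

/-- **HEAD — THE RATIONAL PRINCIPAL CONGRUENCE LEVELS ARE COFINAL IN `U(J)(𝔸_{F,f})`**: for every open subgroup `U` of `U(J)(𝔸_{F,f})` there is `m ∈ ℕ`, `m ≠ 0`, such that every
`g ∈ U(J)(𝔸_{F,f})` with `(1_∞, g) ∈ K(m𝓞_E)` lies in `U`.  (`K(𝔫) ≤ GL_N(𝔸_E)` is the tree's principal congruence subgroup ★ `principalCongruenceLevel`: archimedean part `1`, finite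
part `≡ 1 mod 𝔫`.) [cite: Bump1997, §3.3] [cite: GodementJacquet1972, §10] -/
theorem exists_rationalLevel_subset (U : OpenSubgroup ↥(finAdelic F E c N J)) :
    ∃ m : ℕ, m ≠ 0 ∧ ∀ g : ↥(finAdelic F E c N J),
      GLn.ofFinite N E (g : GL (Fin N) (FiniteAdeleRing (𝓞 E) E)) ∈ principalCongruenceLevel N E (Ideal.span {(m : 𝓞 E)}) → g ∈ U := by
  -- `U = U(J)(𝔸_f) ∩ V`, `V` open in `GL_N(𝔸_{E,f})`
  obtain ⟨V, hVo, hVU⟩ := isOpen_induced_iff.1 U.isOpen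
  have h1V : (1 : GL (Fin N) (FiniteAdeleRing (𝓞 E) E)) ∈ V := by
    have h1 : (1 : ↥(finAdelic F E c N J)) ∈ (U : Set ↥(finAdelic F E c N J)) := U.one_mem
    rw [← hVU] at h1
    exact h1
  -- pull back to `GL_N(𝔸_E)` along the finite-component map and insert a `K(𝔫₀)`
  have hnhds : (GLn.sndHom N E) ⁻¹' V ∈ 𝓝 (1 : GL (Fin N) (AdeleRing (𝓞 E) E)) :=
    (hVo.preimage GLn.continuous_sndHom).mem_nhds (by rw [Set.mem_preimage, map_one]; exact h1V)
  obtain ⟨𝔫₀, h𝔫₀, hsub⟩ := exists_principalCongruenceLevel_subset N E hnhds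
  have hbot : 𝔫₀ ≠ ⊥ := by rw [Ne, ← Submodule.zero_eq_bot]; exact h𝔫₀
  -- the rational level `m := N(𝔫₀) ∈ 𝔫₀`
  refine ⟨Ideal.absNorm 𝔫₀, Ideal.absNorm_eq_zero_iff.not.2 hbot, fun g hg => ?_⟩
  have hle : principalCongruenceLevel N E (Ideal.span {((Ideal.absNorm 𝔫₀ : ℕ) : 𝓞 E)}) ≤ principalCongruenceLevel N E 𝔫₀ :=
    principalCongruenceLevel_mono N E (span_natCast_ne_zero E (Ideal.absNorm_eq_zero_iff.not.2 hbot)) (Ideal.span_le.2 (Set.singleton_subset_iff.2 (Ideal.absNorm_mem 𝔫₀)))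
  have hgV : GLn.ofFinite N E (g : GL (Fin N) (FiniteAdeleRing (𝓞 E) E)) ∈ (GLn.sndHom N E) ⁻¹' V := hsub (hle hg)
  rw [Set.mem_preimage, GLn.sndHom_ofFinite] at hgV
  have hgU : g ∈ Subtype.val ⁻¹' V := hgV
  rw [hVU] at hgU
  exact hgU

/-- **COFINALITY OF THE SELF-CONJUGATE LEVELS**: every open subgroup of `U(J)(𝔸_{F,f})` contains the level set of a NON-ZERO `c`-STABLE ideal `𝔫` of `𝓞 E` (namely `𝔫 = m𝓞_E`, §1 + HEAD).
[cite: Bump1997, §3.3] [cite: PlatonovRapinchuk1994, §5.1] -/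
theorem exists_selfConjugateLevel_subset (U : OpenSubgroup ↥(finAdelic F E c N J)) :
    ∃ 𝔫 : Ideal (𝓞 E), 𝔫 ≠ 0 ∧ c • 𝔫 = 𝔫 ∧ ∀ g : ↥(finAdelic F E c N J),
      GLn.ofFinite N E (g : GL (Fin N) (FiniteAdeleRing (𝓞 E) E)) ∈ principalCongruenceLevel N E 𝔫 → g ∈ U := by
  obtain ⟨m, hm, hU⟩ := exists_rationalLevel_subset F E c N J U
  exact ⟨Ideal.span {(m : 𝓞 E)}, span_natCast_ne_zero E hm, smul_span_natCast F E c m, hU⟩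

/-! ## §3 The `hcof` binder of ★ `atoms_of_cofinal` for the self-conjugate levels of `U(J)(𝔸_{F,f})` -/

/-- **`hcof` OF ★ `K2E1ResidualLevelFiniteOfCofinalU.atoms_of_cofinal` VERBATIM** for `Kf := U(J)(𝔸_{F,f})`, index `ι := {𝔫 // 𝔫 ≠ 0 ∧ c • 𝔫 = 𝔫}` (non-zero self-conjugate levels),
`good := fun _ => True`, `𝒰 𝔫 :=` the open subgroup `{g | (1_∞, g) ∈ K(𝔫)}` of `U(J)(𝔸_{F,f})` (= `K(𝔫).comap (1_∞, ·)` traced on `U(J)`): every open `U` contains some `𝒰 𝔫`.  With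
★ `atoms_of_cofinal` ∕ `residualSpectrumCompact_of_cofinal_atoms`: atoms at the self-conjugate levels (AMENDMENT #3, G11) suffice for 5Res ∕ 12R3.
[cite: Bump1997, §3.3] [cite: PlatonovRapinchuk1994, §5.1] -/
theorem hcof_selfConjugateLevels : ∀ U : OpenSubgroup ↥(finAdelic F E c N J),
    ∃ 𝔫 : {𝔫 : Ideal (𝓞 E) // 𝔫 ≠ 0 ∧ c • 𝔫 = 𝔫}, True ∧
      (⟨((principalCongruenceLevel N E 𝔫.1).comap (GLn.ofFinite N E)).comap (finAdelic F E c N J).subtype,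
          isOpen_setOf_ofFinite_mem_principalCongruenceLevel F E c N J 𝔫.2.1⟩ : OpenSubgroup ↥(finAdelic F E c N J)) ≤ U := by
  intro U
  obtain ⟨𝔫, h𝔫, hc𝔫, hU⟩ := exists_selfConjugateLevel_subset F E c N J U
  exact ⟨⟨𝔫, h𝔫, hc𝔫⟩, trivial, fun g hg => hU g hg⟩

end Summit.HodgeConjecture.HodgeConjecture.Cruxes.H413.K2E1SelfConjugateLevelsCofinalCM

end
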